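import Summits.Ventures.PercRepro.SixFourPLMatch

/-!
# PercRepro — C-025 at `(6,4)`, §22.12.4 step (3): the lpp bound `lpp(π) ≤ lpp(G)` (p3, gen 10)

`lpp(π) = lineSum(π) − Σ_{Q ∈ 𝒫(π)} mult(Q)·credit(Q)` (`lpp_eq`) and, by the identity 22.2 in the form of
`lpp_ge` + `sum_eps_choose_le` (`SixFourT4Lpp` / `SixFourT4Generic`),
`lpp(G) ≥ Σ_ℓ ε(m_ℓ)·C(g − m_ℓ, 2) − Σ_{P : r(P ∩ G) = 3} lppCredit(P)`.  The line side is
`profile_line_sum_le` — the lines of `G` with `m ≥ 3` points are `ℓ` and the lines of `ρ` (`line_trichotomy`), so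
`Σ_m b_m(π)·f(m) ≤ Σ_ℓ f(m_ℓ)` for every `f ≥ 0` vanishing on `m ≤ 2` (the argument of `bonus5sum_profile_le`) —
and the plane side is the domination `sum_tyP_le` with `credit (tyP P) = lppCredit P` (`credit_tyP`).
Main result: **`lpp_profile_le`**, `lpp(π) ≤ lpp(G)`.
-/

namespace PercRepro.SixFour

open Finset ThmH

variable {α : Type*} [DecidableEq α] {M : Matroid α} [M.Finite] {G : Finset α}

/-- `PL.eps = eps`. -/
theorem PLeps_eq (m : ℕ) : PL.eps m = eps m := by
  unfold PL.eps eps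
  rw [PLch_eq_choose]
  omega

/-- `ε(m) = 0` for `m ≤ 2`. -/
theorem eps_le_two {m : ℕ} (hm : m ≤ 2) : eps m = 0 := by
  interval_cases m <;> decide

namespace PLData

variable {D : PLData M G}

/-- **The line side**: `Σ_{m<8} b_m(π)·f(m) ≤ Σ_{ℓ ∈ lines M} f(|ℓ ∩ G|)` for `f ≥ 0` vanishing on `m ≤ 2` — the
line `ℓ` contributes `f(n + e)`, a line meeting `ρ` in `m ≥ 2` points contributes `f(m)`, every other line `≥ 0`. -/
theorem profile_line_sum_le (hs : Simple M) (hG : G ⊆ gr M) (h2 : 2 ≤ D.L.card)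
    (hn6 : D.L.card + (D.ellF ∩ D.ρ).card ≤ 6) (h3 : 3 ≤ D.L.card) (hp7 : D.ρ.card ≤ 7)
    (f : ℕ → ℚ) (hf : ∀ m, 0 ≤ f m) (hf2 : ∀ m ≤ 2, f m = 0) :
    ∑ m ∈ Finset.range 8, (PL.b D.profile m : ℚ) * f m ≤ ∑ L ∈ lines M, f (L ∩ G).card := by
  classical
  have hℓ := (D.ellF_mem_lines hs hG h2).1
  -- the profile sum: `f(n + e) + Σ_{m<8} inc_m·f(m)`
  have hl : PL.lprime D.profile = D.L.card + (D.ellF ∩ D.ρ).card := by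
    unfold PL.lprime
    rw [e_profile_eq hs hG h2]
    rfl
  have hinc0 : PL.incOf D.profile 0 = 0 := by simp [PL.incOf]
  have hinc1 : PL.incOf D.profile 1 = 0 := by simp [PL.incOf]
  have hf0 := hf2 0 (by norm_num)
  have hf1 := hf2 1 (by norm_num)
  have hf2' := hf2 2 (by norm_num)
  obtain ⟨l, hl'⟩ : ∃ l, PL.lprime D.profile = l := ⟨_, rfl⟩
  have hl3 : 3 ≤ l := by omega
  have hl6 : l ≤ 6 := by omega
  have hA : ∑ m ∈ Finset.range 8, (PL.b D.profile m : ℚ) * f m =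
      f l + ∑ m ∈ Finset.range 8, (inc M D.ρ m : ℚ) * f m := by
    unfold PL.b
    rw [hl']
    simp only [Finset.sum_range_succ, Finset.sum_range_zero, hinc0, hinc1,
      incOf_profile (by norm_num : 2 ≤ 2) (by norm_num), incOf_profile (by norm_num : 2 ≤ 3) (by norm_num),
      incOf_profile (by norm_num : 2 ≤ 4) (by norm_num), incOf_profile (by norm_num : 2 ≤ 5) (by norm_num),
      incOf_profile (by norm_num : 2 ≤ 6) (by norm_num), incOf_profile (by norm_num : 2 ≤ 7) (by norm_num),
      hf0, hf1, hf2']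
    push_cast
    interval_cases l <;> simp <;> ring
  rw [hA]
  -- the right side, split at `ℓ`
  have hsplit : ∑ L ∈ lines M, f (L ∩ G).card =
      f (D.ellF ∩ G).card + ∑ L ∈ (lines M).erase D.ellF, f (L ∩ G).card :=
    (Finset.add_sum_erase _ _ hℓ).symm
  rw [hsplit, card_ellF_inter_G_eq hs hG h2, hl']
  -- the lines with `≥ 2` points of `ρ` (all in `(lines M).erase ℓ`) give the profile sum
  have hsub : ∑ L ∈ ((lines M).erase D.ellF).filter (fun L => 2 ≤ (L ∩ D.ρ).card), f (L ∩ G).card ≤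
      ∑ L ∈ (lines M).erase D.ellF, f (L ∩ G).card :=
    Finset.sum_le_sum_of_subset_of_nonneg (Finset.filter_subset _ _) (fun L _ _ => hf _)
  have hfilt : ((lines M).erase D.ellF).filter (fun L => 2 ≤ (L ∩ D.ρ).card) =
      (lines M).filter (fun L => 2 ≤ (L ∩ D.ρ).card) := by
    ext L
    rw [Finset.mem_filter, Finset.mem_filter, Finset.mem_erase]
    constructor
    · rintro ⟨⟨-, hL⟩, h⟩
      exact ⟨hL, h⟩
    · rintro ⟨hL, h⟩
      exact ⟨⟨ne_ellF_of_two_le hs hG h2 h, hL⟩, h⟩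
  rw [hfilt] at hsub
  have hval : ∑ L ∈ (lines M).filter (fun L => 2 ≤ (L ∩ D.ρ).card), f (L ∩ G).card =
      ∑ L ∈ (lines M).filter (fun L => 2 ≤ (L ∩ D.ρ).card), f (L ∩ D.ρ).card := by
    refine Finset.sum_congr rfl (fun L hL => ?_)
    rw [Finset.mem_filter] at hL
    rw [inter_G_eq_inter_ρ_of_two_le hs hL.1 hL.2]
  have hfull : ∑ L ∈ (lines M).filter (fun L => 2 ≤ (L ∩ D.ρ).card), f (L ∩ D.ρ).card =
      ∑ L ∈ lines M, f (L ∩ D.ρ).card := by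
    apply Finset.sum_subset (Finset.filter_subset _ _)
    intro L hL hnot
    rw [Finset.mem_filter] at hnot
    push Not at hnot
    have hc : (L ∩ D.ρ).card < 2 := hnot hL
    exact hf2 _ (by omega)
  have hall : ∑ L ∈ lines M, f (L ∩ D.ρ).card =
      ∑ m ∈ Finset.range (D.ρ.card + 1), (inc M D.ρ m : ℚ) * f m := by
    rw [← Finset.sum_fiberwise_of_maps_to' (g := fun L : Finset α => (L ∩ D.ρ).card)
      (t := Finset.range (D.ρ.card + 1)) (fun L _ => by
        rw [Finset.mem_range]; exact Nat.lt_succ_of_le (Finset.card_le_card Finset.inter_subset_right))]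
    refine Finset.sum_congr rfl (fun m _ => ?_)
    rw [Finset.sum_const, nsmul_eq_mul]
    rfl
  have hext : ∑ m ∈ Finset.range (D.ρ.card + 1), (inc M D.ρ m : ℚ) * f m =
      ∑ m ∈ Finset.range 8, (inc M D.ρ m : ℚ) * f m := by
    refine Finset.sum_subset (fun m hm => by rw [Finset.mem_range] at hm ⊢; omega) (fun m hm hnm => ?_)
    rw [Finset.mem_range] at hm hnm
    rw [inc_eq_zero_of_card_le (eRk_ρ (D := D)) (by omega)]
    simp
  have hkey : ∑ m ∈ Finset.range 8, (inc M D.ρ m : ℚ) * f m ≤ ∑ L ∈ (lines M).erase D.ellF, f (L ∩ G).card := by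
    rw [← hext, ← hall, ← hfull, ← hval]
    exact hsub
  linarith

/-- **Step (3) of 22.12.4**: `lpp(π) ≤ lpp(G)`. -/
theorem lpp_profile_le (hs : Simple M) (hG : G ⊆ gr M) (hpl : ∀ P ∈ planes M, (P ∩ G).card ≤ 7)
    (hg : 10 ≤ G.card) : (PL.lpp D.profile : ℚ) ≤ (lpp M G : ℚ) := by
  obtain ⟨hne, -, hp7, hn3, -⟩ := size_facts (D := D) hs hG hpl hg
  have h2 : 2 ≤ D.L.card := by omega
  -- the line side
  have hline : (PL.lineSum D.profile : ℚ) ≤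
      ∑ L ∈ lines M, ((eps (L ∩ G).card : ℚ) * ((G.card - (L ∩ G).card).choose 2 : ℚ)) := by
    have key := profile_line_sum_le hs hG h2 hne hn3 hp7
      (fun m => (eps m : ℚ) * ((G.card - m).choose 2 : ℚ)) (fun m => by positivity)
      (fun m hm => by rw [eps_le_two hm]; simp)
    have e0 : eps 0 = 0 := by decide
    have e1 : eps 1 = 0 := by decide
    have e2 : eps 2 = 0 := by decide
    simp only [Finset.sum_range_succ, Finset.sum_range_zero, e0, e1, e2, Nat.cast_zero, zero_mul, mul_zero,
      zero_add] at key
    unfold PL.lineSum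
    rw [g_profile, list_sum_range']
    simp only [Finset.sum_range_succ, Finset.sum_range_zero, PLeps_eq, PLch_eq_choose]
    push_cast
    linarith
  -- the plane side
  have hplane : ∑ P ∈ planesR3 M G, (lppCredit M G P : ℚ) ≤
      (((PL.planes D.profile).map fun Q => (Q.mult : ℤ) * PL.credit Q).sum : ℚ) := by
    have h1 : ∑ P ∈ planesR3 M G, (lppCredit M G P : ℚ) = ∑ P ∈ planesR3 M G, ((PL.credit (tyP M G P) : ℤ) : ℚ) := by
      refine Finset.sum_congr rfl (fun P hP => ?_)
      obtain ⟨hP, hr3⟩ := mem_planesR3.1 hP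
      rw [credit_tyP (hpl P hP) hr3]
      push_cast
      rfl
    have h3 : ∑ P ∈ planesR3 M G, ((PL.credit (tyP M G P) : ℤ) : ℚ) ≤
        ((PL.planes D.profile).map fun Q => (Q.mult : ℚ) * ((PL.credit (PL.ty Q) : ℤ) : ℚ)).sum :=
      sum_tyP_le hs hG hpl hg (fun Q => ((PL.credit Q : ℤ) : ℚ)) (fun i _ => by
        exact_mod_cast PL.credit_nonneg _)
    have h4 : ((PL.planes D.profile).map fun Q => (Q.mult : ℚ) * ((PL.credit (PL.ty Q) : ℤ) : ℚ)).sum =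
        (((PL.planes D.profile).map fun Q => (Q.mult : ℤ) * PL.credit Q).sum : ℚ) := by
      push_cast
      rw [List.map_map]
      refine congrArg List.sum (List.map_congr_left (fun Q _ => ?_))
      simp only [Function.comp_apply, Int.cast_mul, Int.cast_natCast, PL.credit_ty]
    rw [h1]
    linarith [h3, h4]
  -- the identity 22.2 as two inequalities (`lpp_ge`, `sum_eps_choose_le`), with `S = planesR3`
  have F9 : ∑ L ∈ lines M, ((eps (L ∩ G).card : ℚ) * ((crossPairs M G L).card : ℚ)) ≤ (lpp M G : ℚ) := by
    have := lpp_ge hs hG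
    have h' : ∑ L ∈ lines M, ((eps (L ∩ G).card : ℚ) * ((crossPairs M G L).card : ℚ)) =
        ((∑ L ∈ lines M, eps (L ∩ G).card * (crossPairs M G L).card : ℕ) : ℚ) := by push_cast; rfl
    rw [h']
    exact_mod_cast this
  have F10 : ∑ L ∈ lines M, ((eps (L ∩ G).card : ℚ) * ((G.card - (L ∩ G).card).choose 2 : ℚ)) ≤
      ∑ L ∈ lines M, ((eps (L ∩ G).card : ℚ) * ((crossPairs M G L).card : ℚ)) +
        ∑ P ∈ planesR3 M G, (lppCredit M G P : ℚ) := by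
    have := sum_eps_choose_le (M := M) (G := G) hs hG
    have h1 : ∑ L ∈ lines M, ((eps (L ∩ G).card : ℚ) * ((G.card - (L ∩ G).card).choose 2 : ℚ)) =
        ((∑ L ∈ lines M, eps (L ∩ G).card * (G.card - (L ∩ G).card).choose 2 : ℕ) : ℚ) := by push_cast; rfl
    have h2' : ∑ L ∈ lines M, ((eps (L ∩ G).card : ℚ) * ((crossPairs M G L).card : ℚ)) =
        ((∑ L ∈ lines M, eps (L ∩ G).card * (crossPairs M G L).card : ℕ) : ℚ) := by push_cast; rfl
    have h3 : ∑ P ∈ planesR3 M G, (lppCredit M G P : ℚ) = ((∑ P ∈ planesR3 M G, lppCredit M G P : ℕ) : ℚ) := by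
      push_cast; rfl
    rw [h1, h2', h3, ← Nat.cast_add]
    exact_mod_cast this
  rw [PL.lpp_eq, Int.cast_sub]
  linarith [hline, hplane, F9, F10]

end PLData

end PercRepro.SixFour
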